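import Summits.QuantumFields.YangMills.Theorems.BalabanUVNodesN15KingModelJetLettersColour
import HarnessLib

/-!
# BalabanUVNodes ∕ N15 — THE KING-MODEL RUNG, PROGRAMME Y (the dressed SOURCE-DIVERGENCE entry of the King jet), FILE 68:
# THE BARE MIXED ROW `N∇_μ′∘A₀⁻¹∘N∇*_μ ⊗ 1 ≤ C·(K+1)·e^{−δ|y−y′|_T}` IN SUP-BLOCK CURRENCY — the logarithm of the number of points per unit block, and nothing worse

WHO ∕ WHEN.  Cell `pub-ymgap`, seat `pub-ymgap-dag-n15-d` (R134, N15 NE2 s3 = King-model rung, g22); `--kind proof --supports stmt-QuantumFields-27366 --as helper`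
(K3⁸; count-neutral).  THEOREMS ONLY (0 `def`).  Over dag-n15-e V-a∕V-b (`fullPropDD_profile_decay_unif`: the (1,1) profile of King's full `A = 0` propagator with
the unit-block decay; `inv_deriv_adjDeriv_eq_sum`: the mixed object as a kernel sum; `levelShell_sum_le`, `LamL2_eq_pow`), dag-n15-e Σ-a `hasMaj_ofBlocks_of_cubeBound`,
dag-n15-a M4 `hasMaj_tensorId` BY NAME; nothing in the tree is modified.  The proof is V-b's `fullPropMixedOp_holder_le` WITHOUT the Hölder gain (`ε = 0`): every
level of the profile then costs `O(1)` instead of `(L^{−ε})^i`, whence the factor `K`.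

WHY (this seat's ARCHITECTURE NOTE «ENTRY 2 LIVE BY PARTS», pub-ymgap INBOX l.43300).  The coarse letter mismatch of the by-parts fixed point
(`ψ_μ = blockAvg(b′_μ) − b̄_μ = −N̄∇̄*_μφ_μ`, `|φ_μ| ≤ (d+1)r∕L^K`) is paid, after one coarse Leibniz step, by `(A₀⁻¹N∇*_μ)∘M_φ∘Ȳ` and `A₀⁻¹∘M_{φ(·−e_μ)}∘(N∇*_μ∘Ȳ)`; the
latter needs the sup-block size of the coarse DRESSED MIXED operator `N∇*_μ∘X̄∘N∇*_κ`, which the jet's Neumann series reduces to the BARE mixed row typed here.  In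
sup-block currency the mixed kernel `≍ |x − y|^{−(d+1)}` is NOT uniformly `ℓ¹` (dag-n15-e V-b, dag-n15-a K-E: «`≍ log n`»): the row is `≤ C·(K+1)` — harmless behind
the rate `L^{−K}` it multiplies in FILE 70.

WHAT.  §1 `symbOp_sD_comp_tensorId` (dictionary `ρ(N(s_μ′ − 1))∘(T ⊗ 1) = (N(τ_{e_μ′} − 1)∘T) ⊗ 1`), ★ `kingMixed_cube_le` (cube format: `|N((A₀⁻¹N∇*_μλ)(x + e_μ′) −
(A₀⁻¹N∇*_μλ)(x))| ≤ C·(K+1)·e^{−δD}·sup|λ|` for `λ` vanishing on the blocks within distance `< D` of `B(x)`, every `K ≥ 1`, `N = L^K`, volume, `0 < m² ≤ m₀²`);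
§2 ★★ `hasMaj_sD_tensorId_kingSOp` (`HasMaj (ofBlocks (unitTorusGeo L K M) (blkFine L K M)) (same) (ρ(N(s_μ′−1))∘(kingSOp_μ ⊗ 1)) (C·(K+1)·e^{−δ|y−y′|_T})` — the coarse
run; the same proof at `K + n` levels gives the fine run with `K + n + 1`, not needed).

HONEST FRAMING ∕ LIMITS.  King's `A = 0` MODEL on finite tori (template literature [King1986] (2.13)–(2.17) p.653, (4.1)–(4.5) p.670) — NOT Bałaban's covariant `G(U)`;
[Balaban1985BackgroundPropagators] (3.44) p.398 cited as SHAPE only (the print's mixed entry carries the Hölder norm of the source precisely because of this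
logarithm).  NE2⁺ NOT PRINTED ∕ NOT proved; no statement of record touched; N15 NOT discharged; K3⁸ OPEN; counts UNMOVED (typed 28∕28 · discharged 5∕27); one finite
torus per index — NOT ℝ⁴ ∕ infinite volume ∕ OS ∕ mass gap ∕ Clay.
-/

noncomputable section

open scoped BigOperators Matrix
open Finset

namespace Summit.QuantumFields.YangMills.BalabanUVNodes.N15.KingModel.SrcDiv

open Literature.MathematicalPhysics.QuantumFieldTheory.Balaban1983to89
open Literature.MathematicalPhysics.QuantumFieldTheory.Balaban1983to89.B11SectG (BlockNorm HasMaj)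
open Literature.MathematicalPhysics.QuantumFieldTheory.Balaban1983to89.T4EtaRateCoeffDefect (pull pull_apply)
open Literature.MathematicalPhysics.QuantumFieldTheory.Balaban1983to89.B5Prop11Plancherel (Tor fine unitVec)
open Literature.MathematicalPhysics.QuantumFieldTheory.King1986 (aK)
open Literature.MathematicalPhysics.QuantumFieldTheory.King1986.Torus (fineOp constrainedProp blockOf tdistT tdistT_nonneg tdistT_symm)
open Literature.MathematicalPhysics.QuantumFieldTheory.Balaban1983to89.B6UnitTorusCarrier (unitTorusGeo)
open Summit.QuantumFields.YangMills.BalabanUVNodes.N15.VectorPiece (blkFine tensorId tensorId_apply hasMaj_tensorId unitTorusGeoS)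
open Summit.QuantumFields.YangMills.BalabanUVNodes.N15.TwoGrid (symbOp sD symbOp_sD_apply)
open Summit.QuantumFields.YangMills.BalabanUVNodes.N15KingModelRung.Curved (kingGOp kingSOp kingSOp_apply fullPropDD_profile_decay_unif inv_deriv_adjDeriv_eq_sum
  levelShell_sum_le LamL2_eq_pow hasMaj_ofBlocks_of_cubeBound)

variable {d : ℕ} (L : ℕ) [NeZero L]

/-! ## §1 The mixed row in cube format -/

section Cube

variable (N : ℕ) [NeZero N] (M : Fin (d + 1) → ℕ) [∀ μ, NeZero (M μ)]

omit [NeZero L] [NeZero N] [∀ μ, NeZero (M μ)] in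
/-- DICTIONARY: `ρ(N(s_μ′ − 1))∘(T ⊗ 1) = (N(τ_{e_μ′} − 1)∘T) ⊗ 1`. [folklore] -/
theorem symbOp_sD_comp_tensorId (T : (Tor (fine N M) → ℝ) →ₗ[ℝ] (Tor (fine N M) → ℝ)) (μ' : Fin (d + 1)) :
    symbOp M N (sD M N μ' ((N : ℕ) : ℝ)) ∘ₗ tensorId (Fin (d + 1)) T
      = tensorId (Fin (d + 1)) ((((N : ℕ) : ℝ) • (pull (fun x : Tor (fine N M) => x + unitVec (fine N M) μ') - LinearMap.id)) ∘ₗ T) := by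
  refine LinearMap.ext fun f => funext fun p => ?_
  rw [LinearMap.comp_apply, symbOp_sD_apply, tensorId_apply, tensorId_apply, tensorId_apply, LinearMap.comp_apply, LinearMap.smul_apply,
    LinearMap.sub_apply, Pi.smul_apply, Pi.sub_apply, pull_apply, LinearMap.id_apply, smul_eq_mul]

variable {L}

/-- ★ **THE BARE MIXED ROW, CUBE FORMAT**: for odd `L ≥ 3`, `a > 0`, `m₀² ≥ 0` there are `C, δ > 0` such that for every `K ≥ 1` (`N = L^K`), cube `M_μ = 2L^e`, mass
`0 < m² ≤ m₀²`, directions `μ, μ′`, every source `λ` with `|λ| ≤ F`, every `x` and every `D : ℕ` with `λ` vanishing on the unit blocks at distance `< D` from `B(x)`: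
`|N·((A₀⁻¹N∇*_μλ)(x + e_μ′) − (A₀⁻¹N∇*_μλ)(x))| ≤ C·(K+1)·e^{−δD}·F` — dag-n15-e V-a's (1,1) profile (`≍ |x−y|^{−(d+1)}` with the unit-block decay) summed level by
level: each of the `K` levels costs `O(1)` (V-b `levelShell_sum_le` at `ε = 0`). [cite: Balaban1985BackgroundPropagators, Thm 3.1 (3.44) p.398 (object, shape);
King1986, (2.13) p.653, Prop. 3.7 (3.63) p.663; Balaban1983RegularityDecay, Theorem (1.10) p.573] -/
theorem kingMixed_cube_le (hLodd : Odd L) (hL : 2 ≤ L) {a : ℝ} (ha : 0 < a) {m0sq : ℝ} (hm0 : 0 ≤ m0sq) :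
    ∃ C δ : ℝ, 0 < C ∧ 0 < δ ∧ ∀ (K : ℕ), 1 ≤ K → ∀ (N : ℕ) [NeZero N], N = L ^ K →
      ∀ (e : ℕ) (M : Fin (d + 1) → ℕ) [∀ μ, NeZero (M μ)], (∀ μ, M μ = 2 * L ^ e) →
      ∀ (msq : ℝ), 0 < msq → msq ≤ m0sq → ∀ (μ μ' : Fin (d + 1)) (lam : Tor (fine N M) → ℝ) (F : ℝ) (D : ℕ),
        (∀ y, |lam y| ≤ F) → ∀ x : Tor (fine N M), (∀ y, lam y ≠ 0 → (D : ℝ) ≤ tdistT M (blockOf N M x) (blockOf N M y)) →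
        |(N : ℝ) * (((fineOp N M (aK a L K) (((N : ℕ) : ℝ) ^ 2) msq)⁻¹
                *ᵥ (fun y => (N : ℝ) * (lam (y - unitVec (fine N M) μ) - lam y))) (x + unitVec (fine N M) μ')
            - ((fineOp N M (aK a L K) (((N : ℕ) : ℝ) ^ 2) msq)⁻¹
                *ᵥ (fun y => (N : ℝ) * (lam (y - unitVec (fine N M) μ) - lam y))) x)|
          ≤ C * ((K : ℝ) + 1) * Real.exp (-(δ * D)) * F := by
  have hL1 : 1 < L := by omega
  have hLr : (1 : ℝ) < L := by exact_mod_cast hL1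
  have hL0 : (0 : ℝ) < L := by linarith
  obtain ⟨C₀, δ₀, hC₀, hδ₀, HDD⟩ := fullPropDD_profile_decay_unif (d := d) L hLodd hL ha hm0
  set δ₁ : ℝ := min δ₀ 1 with hδ₁def
  have hδ₁0 : 0 < δ₁ := lt_min hδ₀ one_pos
  have hδ₁δ : δ₁ ≤ δ₀ := min_le_left _ _
  have hδ₁1 : δ₁ ≤ 1 := min_le_right _ _
  set A₁ : ℝ := 2 * (8 * ((d : ℝ) + 1) / δ₁) ^ (d + 1) with hA₁def
  have hA₁ : 0 < A₁ := by positivity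
  refine ⟨C₀ * A₁, δ₀, mul_pos hC₀ hA₁, hδ₀, ?_⟩
  intro K hK N _ hN e M _ hM msq hmsq hcap μ μ' lam F D hF x hD
  have hN1 : (1 : ℝ) ≤ (N : ℝ) := by rw [hN]; exact_mod_cast Nat.one_le_pow K L (by omega)
  have hN0 : 0 < (N : ℝ) := by linarith
  have hNK : ((N : ℝ)) = (L : ℝ) ^ K := by rw [hN, Nat.cast_pow]
  have hF0 : 0 ≤ F := (abs_nonneg _).trans (hF x)
  -- the kernel sum (V-b), the kernel as a named function
  rw [inv_deriv_adjDeriv_eq_sum]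
  obtain ⟨DDk, hDDk⟩ : ∃ f : Tor (fine N M) → ℝ, ∀ y, f y
      = (N : ℝ) * ((N : ℝ) * (constrainedProp N M (aK a L K) (((N : ℕ) : ℝ) ^ 2) msq (y + unitVec (fine N M) μ) (x + unitVec (fine N M) μ')
            - constrainedProp N M (aK a L K) (((N : ℕ) : ℝ) ^ 2) msq y (x + unitVec (fine N M) μ'))
          - (N : ℝ) * (constrainedProp N M (aK a L K) (((N : ℕ) : ℝ) ^ 2) msq (y + unitVec (fine N M) μ) x
            - constrainedProp N M (aK a L K) (((N : ℕ) : ℝ) ^ 2) msq y x)) := ⟨_, fun _ => rfl⟩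
  rw [Finset.sum_congr rfl fun y _ => by rw [← hDDk y]]
  set c : ℝ := ((N : ℝ) ^ (d + 1))⁻¹ with hcdef
  have hc0 : 0 < c := by positivity
  have hcN : c * (N : ℝ) ^ (d + 1) = 1 := by rw [hcdef, inv_mul_cancel₀ (pow_ne_zero _ hN0.ne')]
  -- the level sums at the rate `δ₁`, as a named function of the source point
  obtain ⟨S₁, hS₁⟩ : ∃ f : Tor (fine N M) → ℝ, ∀ y, f y = ∑ i ∈ Finset.range K, ((L : ℝ) ^ (d + 1) / (L : ℝ) ^ 2 * L * L) ^ i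
      * Real.exp (-(δ₁ * (tdistT (fine N M) x y * (L : ℝ) ^ i / (N : ℝ)))) := ⟨_, fun _ => rfl⟩
  have hS₁0 : ∀ y, 0 ≤ S₁ y := fun y => by rw [hS₁]; exact Finset.sum_nonneg fun i _ => by positivity
  -- termwise: `|c·DD(y,x)·λ(y)| ≤ c·C₀·F·e^{−δ₀D}·S₁(y)`
  have hterm : ∀ y, |c * DDk y * lam y| ≤ c * C₀ * F * Real.exp (-(δ₀ * D)) * S₁ y := by
    intro y
    by_cases hy0 : lam y = 0
    · rw [hy0, mul_zero, abs_zero]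
      have := hS₁0 y
      positivity
    have hdd : |DDk y| ≤ C₀ * (∑ i ∈ Finset.range K, ((L : ℝ) ^ (d + 1) / (L : ℝ) ^ 2 * L * L) ^ i
          * Real.exp (-(δ₀ * (tdistT (fine N M) y x * (L : ℝ) ^ i / (N : ℝ)))))
        * Real.exp (-(δ₀ * tdistT M (blockOf N M y) (blockOf N M x))) := by
      rw [hDDk]
      exact HDD K hK N hN e M hM msq hmsq hcap μ μ' y x
    have hdec : Real.exp (-(δ₀ * tdistT M (blockOf N M y) (blockOf N M x))) ≤ Real.exp (-(δ₀ * D)) := by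
      rw [tdistT_symm]
      exact Real.exp_le_exp.mpr (neg_le_neg (mul_le_mul_of_nonneg_left (hD y hy0) hδ₀.le))
    have hprof : ∑ i ∈ Finset.range K, ((L : ℝ) ^ (d + 1) / (L : ℝ) ^ 2 * L * L) ^ i
          * Real.exp (-(δ₀ * (tdistT (fine N M) y x * (L : ℝ) ^ i / (N : ℝ)))) ≤ S₁ y := by
      rw [hS₁]
      refine Finset.sum_le_sum fun i _ => mul_le_mul_of_nonneg_left ?_ (by positivity)
      rw [tdistT_symm]
      apply Real.exp_le_exp.mpr
      have h0 : 0 ≤ tdistT (fine N M) x y * (L : ℝ) ^ i / (N : ℝ) := by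
        have := tdistT_nonneg (fine N M) x y; positivity
      nlinarith [mul_le_mul_of_nonneg_right hδ₁δ h0]
    have hDD' : |DDk y| ≤ C₀ * S₁ y * Real.exp (-(δ₀ * D)) :=
      hdd.trans (mul_le_mul (mul_le_mul_of_nonneg_left hprof hC₀.le) hdec (Real.exp_pos _).le (mul_nonneg hC₀.le (hS₁0 y)))
    calc |c * DDk y * lam y| = c * |DDk y| * |lam y| := by rw [abs_mul, abs_mul, abs_of_pos hc0]
      _ ≤ c * (C₀ * S₁ y * Real.exp (-(δ₀ * D))) * F :=
          mul_le_mul (mul_le_mul_of_nonneg_left hDD' hc0.le) (hF y) (abs_nonneg _) (by have := hS₁0 y; positivity)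
      _ = c * C₀ * F * Real.exp (-(δ₀ * D)) * S₁ y := by ring
  -- the levels: `Σ_y S₁(y) ≤ A₁·N^{d+1}·K` (every level costs `A₁·N^{d+1}`)
  have hlevel : ∀ i ∈ Finset.range K, ((L : ℝ) ^ (d + 1) / (L : ℝ) ^ 2 * L * L) ^ i
      * ∑ y, Real.exp (-(δ₁ * (tdistT (fine N M) x y * (L : ℝ) ^ i / (N : ℝ)))) ≤ A₁ * (N : ℝ) ^ (d + 1) := by
    intro i hi
    have hiK : i < K := Finset.mem_range.mp hi
    have hq1 : (1 : ℝ) ≤ (L : ℝ) ^ i := one_le_pow₀ hLr.le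
    have hq0 : (0 : ℝ) < (L : ℝ) ^ i := by linarith
    have hqN : (L : ℝ) ^ i ≤ (N : ℝ) := by rw [hNK]; exact pow_le_pow_right₀ hLr.le hiK.le
    have hS := levelShell_sum_le N M (q := (L : ℝ) ^ i) hq1 hqN hδ₁0 hδ₁1 le_rfl zero_le_one x
    simp only [neg_zero, Real.rpow_zero, one_mul, mul_one] at hS
    have hΛ : ((L : ℝ) ^ (d + 1) / (L : ℝ) ^ 2 * L * L) ^ i = ((L : ℝ) ^ i) ^ (d + 1) := by
      rw [LamL2_eq_pow L hL, ← pow_mul, ← pow_mul, Nat.mul_comm]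
    have h8 : 8 * ((d : ℝ) + 1) * (N : ℝ) / (δ₁ * (L : ℝ) ^ i) = (8 * ((d : ℝ) + 1) / δ₁) * ((N : ℝ) / (L : ℝ) ^ i) :=
      (div_mul_div_comm _ _ _ _).symm
    have halg : ((L : ℝ) ^ i) ^ (d + 1) * (2 * (8 * ((d : ℝ) + 1) * (N : ℝ) / (δ₁ * (L : ℝ) ^ i)) ^ (d + 1)) = A₁ * (N : ℝ) ^ (d + 1) := by
      have hqd : ((L : ℝ) ^ i) ^ (d + 1) ≠ 0 := pow_ne_zero _ hq0.ne'
      rw [h8, mul_pow, div_pow (N : ℝ), hA₁def,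
        show ((L : ℝ) ^ i) ^ (d + 1) * (2 * ((8 * ((d : ℝ) + 1) / δ₁) ^ (d + 1) * ((N : ℝ) ^ (d + 1) / ((L : ℝ) ^ i) ^ (d + 1))))
          = 2 * (8 * ((d : ℝ) + 1) / δ₁) ^ (d + 1) * (N : ℝ) ^ (d + 1) * (((L : ℝ) ^ i) ^ (d + 1) / ((L : ℝ) ^ i) ^ (d + 1)) by ring,
        div_self hqd, mul_one]
    rw [hΛ]
    calc ((L : ℝ) ^ i) ^ (d + 1) * ∑ y, Real.exp (-(δ₁ * (tdistT (fine N M) x y * (L : ℝ) ^ i / (N : ℝ))))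
        ≤ ((L : ℝ) ^ i) ^ (d + 1) * (2 * (8 * ((d : ℝ) + 1) * (N : ℝ) / (δ₁ * (L : ℝ) ^ i)) ^ (d + 1)) :=
          mul_le_mul_of_nonneg_left hS (by positivity)
      _ = A₁ * (N : ℝ) ^ (d + 1) := halg
  have hΦsum : ∑ y, S₁ y ≤ A₁ * (N : ℝ) ^ (d + 1) * K := by
    calc ∑ y, S₁ y
        = ∑ y, ∑ i ∈ Finset.range K, ((L : ℝ) ^ (d + 1) / (L : ℝ) ^ 2 * L * L) ^ i
            * Real.exp (-(δ₁ * (tdistT (fine N M) x y * (L : ℝ) ^ i / (N : ℝ)))) := Finset.sum_congr rfl fun y _ => hS₁ y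
      _ = ∑ i ∈ Finset.range K, ∑ y, ((L : ℝ) ^ (d + 1) / (L : ℝ) ^ 2 * L * L) ^ i
            * Real.exp (-(δ₁ * (tdistT (fine N M) x y * (L : ℝ) ^ i / (N : ℝ)))) := Finset.sum_comm
      _ = ∑ i ∈ Finset.range K, ((L : ℝ) ^ (d + 1) / (L : ℝ) ^ 2 * L * L) ^ i
            * ∑ y, Real.exp (-(δ₁ * (tdistT (fine N M) x y * (L : ℝ) ^ i / (N : ℝ)))) :=
          Finset.sum_congr rfl fun i _ => by rw [Finset.mul_sum]
      _ ≤ ∑ i ∈ Finset.range K, A₁ * (N : ℝ) ^ (d + 1) := Finset.sum_le_sum hlevel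
      _ = A₁ * (N : ℝ) ^ (d + 1) * K := by rw [Finset.sum_const, Finset.card_range, nsmul_eq_mul]; ring
  -- assemble
  calc |∑ y, c * DDk y * lam y| ≤ ∑ y, |c * DDk y * lam y| := Finset.abs_sum_le_sum_abs _ _
    _ ≤ ∑ y, c * C₀ * F * Real.exp (-(δ₀ * D)) * S₁ y := Finset.sum_le_sum fun y _ => hterm y
    _ = c * C₀ * F * Real.exp (-(δ₀ * D)) * ∑ y, S₁ y := by rw [Finset.mul_sum]
    _ ≤ c * C₀ * F * Real.exp (-(δ₀ * D)) * (A₁ * (N : ℝ) ^ (d + 1) * K) := mul_le_mul_of_nonneg_left hΦsum (by positivity)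
    _ = (c * (N : ℝ) ^ (d + 1)) * (C₀ * A₁) * K * Real.exp (-(δ₀ * D)) * F := by ring
    _ = C₀ * A₁ * K * Real.exp (-(δ₀ * D)) * F := by rw [hcN, one_mul]
    _ ≤ C₀ * A₁ * ((K : ℝ) + 1) * Real.exp (-(δ₀ * D)) * F := by
        have h0 : 0 ≤ C₀ * A₁ * Real.exp (-(δ₀ * D)) * F := by positivity
        nlinarith

end Cube

/-! ## §2 ★★ The bare mixed row as a block majorant (coarse run) -/

section Maj

variable {L}

/-- ★★ **THE BARE MIXED ROW `N∇_μ′∘A₀⁻¹∘N∇*_μ ⊗ 1 ≤ C·(K+1)·e^{−δ|y−y′|_T}`, SUP-BLOCK CURRENCY, COARSE RUN** — the logarithm of the number of points per unit block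
(`K·log L`) and nothing worse; §1 read through dag-n15-e's cube-format dictionary and lifted to the coloured carrier.  (Consumer: FILE 70's bound on the coarse
dressed mixed operator `N∇*_μ∘X̄∘N∇*_κ`, behind the rate `L^{−K}`.) [cite: Balaban1985BackgroundPropagators, Thm 3.1 (3.44) p.398 (shape); King1986, (2.13) p.653,
(4.1)–(4.5) p.670; Balaban1983RegularityDecay, Theorem (1.10) p.573] -/
theorem hasMaj_sD_tensorId_kingSOp (hLodd : Odd L) (hL : 2 ≤ L) {a : ℝ} (ha : 0 < a) {m0sq : ℝ} (hm0 : 0 ≤ m0sq) :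
    ∃ C δ : ℝ, 0 < C ∧ 0 < δ ∧ ∀ (K : ℕ), 1 ≤ K → ∀ (e : ℕ) (M : Fin (d + 1) → ℕ) [∀ μ, NeZero (M μ)], (∀ μ, M μ = 2 * L ^ e) →
      ∀ (msq : ℝ), 0 < msq → msq ≤ m0sq → ∀ (μ μ' : Fin (d + 1)),
      HasMaj (BlockNorm.ofBlocks (unitTorusGeo L K M) (blkFine L K M)) (BlockNorm.ofBlocks (unitTorusGeo L K M) (blkFine L K M))
        (symbOp M (L ^ K) (sD M (L ^ K) μ' ((L ^ K : ℕ) : ℝ)) ∘ₗ tensorId (Fin (d + 1)) (kingSOp L a msq K (L ^ K) M μ))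
        (fun y y' => C * ((K : ℝ) + 1) * Real.exp (-(δ * tdistT M y y'))) := by
  obtain ⟨C, δ, hC, hδ, H⟩ := kingMixed_cube_le (d := d) hLodd hL ha hm0
  refine ⟨C, δ, hC, hδ, fun K hK e M _ hM msq hmsq hcap μ μ' => ?_⟩
  have hCK : 0 ≤ C * ((K : ℝ) + 1) := by positivity
  have hscal : HasMaj (BlockNorm.ofBlocks (unitTorusGeoS L K M 1) (blockOf (L ^ K) M)) (BlockNorm.ofBlocks (unitTorusGeoS L K M 1) (blockOf (L ^ K) M))
      ((((L ^ K : ℕ) : ℝ) • (pull (fun x : Tor (fine (L ^ K) M) => x + unitVec (fine (L ^ K) M) μ') - LinearMap.id)) ∘ₗ kingSOp L a msq K (L ^ K) M μ)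
      (fun y y' => C * ((K : ℝ) + 1) * Real.exp (-(δ * tdistT M y y'))) := by
    refine hasMaj_ofBlocks_of_cubeBound L _ _ _ hCK fun lam F D hF x hD => ?_
    rw [LinearMap.comp_apply, LinearMap.smul_apply, LinearMap.sub_apply, Pi.smul_apply, Pi.sub_apply, pull_apply, LinearMap.id_apply, smul_eq_mul,
      kingSOp_apply, kingSOp_apply]
    exact H K hK (L ^ K) rfl e M hM msq hmsq hcap μ μ' lam F D hF x hD
  rw [symbOp_sD_comp_tensorId]
  exact hasMaj_tensorId (Fin (d + 1)) (fun y y' => mul_nonneg hCK (Real.exp_nonneg _)) hscal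

end Maj

end Summit.QuantumFields.YangMills.BalabanUVNodes.N15.KingModel.SrcDiv
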